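import Mathlib
import HarnessLib
import Summits.Ventures.LatticeQCDFlow.Scoring.ChainMeanSquareError
import Summits.Ventures.LatticeQCDFlow.Scoring.WarmStartTransfer
import Summits.Ventures.LatticeQCDFlow.Scoring.RestartTimeAverage

/-!
# The self-normalised (ratio / reweighting) estimator along a Doeblin chain has a certified
# mean-square error from ANY start — and so does the correlated-restart reweighting of row 8's
# non-equilibrium protocol

HONEST FRAMING: exact (Metropolis-corrected) sampling algorithms for lattice gauge theory;
figures of merit are autocorrelation/cost numbers at stated couplings and volumes; no
continuum-physics claim.

Venture `LatticeQCDFlow` (cell pub-lqcd), topic `Scoring`; FANOUT row 8 (`s0-cpn-nemc`, GEN-13).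
NEW WORK of the cell, not a published result; no definition is introduced.  The estimator row 8
actually runs (RESULTS §1: `Σ_i O_i e^{−W_i} / Σ_i e^{−W_i}` over non-equilibrium evolutions started
from consecutive states of ONE prior chain) is a RATIO of two time averages of a Markov chain; every
earlier file of the row stopped at "NOT CLAIMED: the self-normalised ratio estimator".  This file
prices it: an elementary perturbation bound for `A/B − a/b` when the denominator observable has a
floor `β > 0`, composed with `Scoring/ChainMeanSquareError.lean` (`chain_mse_le_of_doeblin`: from any
start, `E[(A_N − πf)²] ≤ (2/ε − 1) Var_π f / N + 16 C'²/(ε² N²)`), and instantiated on the restart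
chain of `Scoring/RestartChainAutocorrelation.lean` / `Scoring/RestartTimeAverage.lean` (invariant law
`Π = π₀ ⊗ₘ κF`, Doeblin constant inherited from the prior chain: `invariant_restart`,
`restart_doeblin`).  The identification of the limiting ratio with a target expectation (Jarzynski /
Crooks: `∫ e^{−W} dΠ = Z₁/Z₀`, `Scoring/RestartJarzynskiWeights.restart_jarzynski_mean`; row 13's
`Exactness/NCMCGeneralSpace*`) is NOT restated here: the theorem is about the ratio of the two
stationary means, whatever they are.  Printed counterpart NAMED ONLY: MSE bounds for ratio /
self-normalised importance-sampling estimators under uniform ergodicity (e.g. Agapiou, Papaspiliopoulos,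
Sanz-Alonso, Stuart 2017, Statist. Sci. 32, Thm 2.1 for i.i.d. proposals; named, not cited as a fact).

## Content (`κ` Markov, `π` invariant, DOEBLIN BY `π`: `κ(x, ·) ≥ ε π`, `ε > 0`; `μ₀` ANY probability
## law; `f` bounded measurable `|f| ≤ C_f` (numerator); `g` measurable with `β ≤ g ≤ C_g`, `β > 0`
## (denominator); `A_N, B_N` their time averages over `X_0 … X_{N−1}`)

* `div_sub_div_eq_of_ne`, `sq_div_sub_div_le` — `A/B − a/b = ((A − a) + (a/b)(b − B))/B` and, for
  `0 < β ≤ B`, `b ≠ 0`: `(A/B − a/b)² ≤ 2((A − a)² + (a/b)²(B − b)²)/β²`;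
* `le_timeAverage`, `le_integral_of_le` — the floor passes to time averages and to `πg`;
* **`chain_ratio_mse_le`** — for every initial law and `N ≥ 1`:
  `E_{μ₀}[(A_N/B_N − πf/πg)²] ≤ (2/β²) · (E_{μ₀}[(A_N − πf)²] + (πf/πg)² E_{μ₀}[(B_N − πg)²])`
  (no Markov / Doeblin hypothesis: any law on path space under which the two squared errors are what
  they are — stated for the trajectory measure);
* **`chain_ratio_mse_le_of_doeblin`** — THE CERTIFIED BOUND: with `M_h := (2/ε − 1) Var_π h / N +
  16 (C_h + |πh|)²/(ε² N²)`, `E_{μ₀}[(A_N/B_N − πf/πg)²] ≤ (2/β²)(M_f + (πf/πg)² M_g)` — order `1/N`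
  from any start, constants explicit in `ε`, `β` and the ranges;
* **`restart_ratio_mse_le_of_doeblin`** — THE INSTANCE FOR ROW 8's PROTOCOL CLASS: along the restart
  chain `K(x, ω) = κ₀ x ⊗ₘ κF` (records `ω` of independent evolutions launched from consecutive states
  of a prior chain `κ₀` with invariant law `π₀` and Doeblin constant `ε`), for record observables
  `G₁` (bounded) and `G₂ ∈ [β, C]` (e.g. `O(end) · e^{−W}` and `e^{−W}` under a two-sided work window)
  and ANY start: `E[(Σ G₁ / Σ G₂ − Π G₁ / Π G₂)²] ≤ (2/β²)(M_{G₁} + (ΠG₁/ΠG₂)² M_{G₂})` with the prior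
  chain's `ε`.

Reading (value-free): the reweighting estimator of the non-equilibrium protocol needs no
independence between evolutions and no burn-in argument for an honest error budget — the prior
sweep's minorisation constant and the work window give an explicit `O(1/N)` mean-square error;
correlated starts cost exactly what they cost the plain time average.  NOT CLAIMED: any `ε`, `β` or
work window for a concrete protocol (a two-sided work bound holds on a finite lattice with bounded
action differences but its value is not typed here); the bias/variance split of the ratio estimator;
optimality of the factor `2/β²`; unbounded weights.
-/

noncomputable section

namespace Summit.Ventures.LatticeQCDFlow.Scoring

open MeasureTheory ProbabilityTheory Filter Finset Preorder
open scoped ENNReal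

/-! ### The perturbation bound for a ratio -/

section Algebra

/-- `A/B − a/b = ((A − a) + (a/b)(b − B))/B` (`B, b ≠ 0`). -/
theorem div_sub_div_eq_of_ne {A B a b : ℝ} (hB : B ≠ 0) (hb : b ≠ 0) :
    A / B - a / b = ((A - a) + a / b * (b - B)) / B := by
  field_simp
  ring

/-- **Ratio perturbation**: `0 < β ≤ B`, `b ≠ 0` ⇒ `(A/B − a/b)² ≤ 2((A − a)² + (a/b)²(B − b)²)/β²`. -/
theorem sq_div_sub_div_le {A B a b β : ℝ} (hβ : 0 < β) (hB : β ≤ B) (hb : b ≠ 0) :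
    (A / B - a / b) ^ 2 ≤ 2 * ((A - a) ^ 2 + (a / b) ^ 2 * (B - b) ^ 2) / β ^ 2 := by
  have hB0 : 0 < B := hβ.trans_le hB
  rw [div_sub_div_eq_of_ne hB0.ne' hb, div_pow]
  have hnum : ((A - a) + a / b * (b - B)) ^ 2 ≤ 2 * ((A - a) ^ 2 + (a / b) ^ 2 * (B - b) ^ 2) := by
    nlinarith [sq_nonneg ((A - a) - a / b * (b - B))]
  have h2 : 0 ≤ 2 * ((A - a) ^ 2 + (a / b) ^ 2 * (B - b) ^ 2) := by positivity
  calc ((A - a) + a / b * (b - B)) ^ 2 / B ^ 2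
      ≤ 2 * ((A - a) ^ 2 + (a / b) ^ 2 * (B - b) ^ 2) / B ^ 2 :=
        div_le_div_of_nonneg_right hnum (by positivity)
    _ ≤ 2 * ((A - a) ^ 2 + (a / b) ^ 2 * (B - b) ^ 2) / β ^ 2 :=
        div_le_div_of_nonneg_left h2 (by positivity) (sq_le_sq' (by linarith) hB)

end Algebra

/-! ### The ratio of two time averages -/

section Chain

variable {Ω : Type*} [MeasurableSpace Ω]
variable {κ : Kernel Ω Ω} [IsMarkovKernel κ] {μ₀ : Measure Ω} [IsProbabilityMeasure μ₀]
  {π : Measure Ω} [IsProbabilityMeasure π]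

omit [MeasurableSpace Ω] in
/-- A pointwise floor passes to time averages: `β ≤ g ⇒ β ≤ (1/N) Σ_{i<N} g(x_i)` (`N ≥ 1`). -/
theorem le_timeAverage {g : Ω → ℝ} {β : ℝ} (hβ : ∀ x, β ≤ g x) {N : ℕ} (hN : N ≠ 0) (x : ℕ → Ω) :
    β ≤ (∑ i ∈ Finset.range N, g (x i)) / N := by
  have hNpos : (0 : ℝ) < N := by exact_mod_cast Nat.pos_of_ne_zero hN
  rw [le_div_iff₀ hNpos]
  calc β * N = ∑ _i ∈ Finset.range N, β := by
        rw [Finset.sum_const, Finset.card_range, nsmul_eq_mul, mul_comm]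
    _ ≤ ∑ i ∈ Finset.range N, g (x i) := Finset.sum_le_sum fun i _ => hβ (x i)

/-- … and to the mean: `β ≤ g` bounded measurable ⇒ `β ≤ ∫ g dπ`. -/
theorem le_integral_of_le {g : Ω → ℝ} (hg : Measurable g) {C β : ℝ} (hC : ∀ x, |g x| ≤ C)
    (hβ : ∀ x, β ≤ g x) : β ≤ ∫ x, g x ∂π := by
  calc β = ∫ _x, β ∂π := by rw [integral_const, probReal_univ, one_smul]
    _ ≤ ∫ x, g x ∂π := integral_mono (integrable_const β) (integrable_of_bounded π hg hC) hβ

/-- **The ratio of two time averages, any law of the errors**: with `β ≤ g` (`β > 0`), `πg ≠ 0` is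
automatic and for every initial law and `N ≥ 1`,
`E_{μ₀}[(A_N/B_N − πf/πg)²] ≤ (2/β²) (E_{μ₀}[(A_N − πf)²] + (πf/πg)² E_{μ₀}[(B_N − πg)²])`. -/
theorem chain_ratio_mse_le {f g : Ω → ℝ} (hf : Measurable f) {Cf : ℝ} (hCf : ∀ x, |f x| ≤ Cf)
    (hg : Measurable g) {Cg β : ℝ} (hCg : ∀ x, |g x| ≤ Cg) (hβ : 0 < β) (hβg : ∀ x, β ≤ g x)
    {N : ℕ} (hN : N ≠ 0) :
    ∫ x, ((∑ i ∈ Finset.range N, f (x i)) / N / ((∑ i ∈ Finset.range N, g (x i)) / N)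
          - (∫ z, f z ∂π) / (∫ z, g z ∂π)) ^ 2
        ∂(Kernel.trajMeasure (X := fun _ : ℕ => Ω) μ₀
          (fun n : ℕ => κ.comap (fun h : (i : ↥(Finset.Iic n)) → Ω => h ⟨n, Finset.mem_Iic.2 le_rfl⟩)
            (measurable_pi_apply _)))
      ≤ 2 / β ^ 2 *
        (∫ x, ((∑ i ∈ Finset.range N, f (x i)) / N - ∫ z, f z ∂π) ^ 2
            ∂(Kernel.trajMeasure (X := fun _ : ℕ => Ω) μ₀
              (fun n : ℕ => κ.comap (fun h : (i : ↥(Finset.Iic n)) → Ω => h ⟨n, Finset.mem_Iic.2 le_rfl⟩)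
                (measurable_pi_apply _)))
          + ((∫ z, f z ∂π) / (∫ z, g z ∂π)) ^ 2 *
            ∫ x, ((∑ i ∈ Finset.range N, g (x i)) / N - ∫ z, g z ∂π) ^ 2
              ∂(Kernel.trajMeasure (X := fun _ : ℕ => Ω) μ₀
                (fun n : ℕ => κ.comap (fun h : (i : ↥(Finset.Iic n)) → Ω => h ⟨n, Finset.mem_Iic.2 le_rfl⟩)
                  (measurable_pi_apply _)))) := by
  set P := Kernel.trajMeasure (X := fun _ : ℕ => Ω) μ₀
      (fun n : ℕ => κ.comap (fun h : (i : ↥(Finset.Iic n)) → Ω => h ⟨n, Finset.mem_Iic.2 le_rfl⟩)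
        (measurable_pi_apply _)) with hP
  set a := ∫ z, f z ∂π with ha
  set b := ∫ z, g z ∂π with hb
  have hbβ : β ≤ b := le_integral_of_le hg hCg hβg
  have hb0 : b ≠ 0 := (hβ.trans_le hbβ).ne'
  -- the two time averages as path functionals
  have hAm : Measurable fun x : ℕ → Ω => (∑ i ∈ Finset.range N, f (x i)) / N := measurable_timeAverage hf N
  have hBm : Measurable fun x : ℕ → Ω => (∑ i ∈ Finset.range N, g (x i)) / N := measurable_timeAverage hg N
  have hAb : ∀ x : ℕ → Ω, |(∑ i ∈ Finset.range N, f (x i)) / N| ≤ Cf := abs_timeAverage_le hCf hN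
  have hBb : ∀ x : ℕ → Ω, |(∑ i ∈ Finset.range N, g (x i)) / N| ≤ Cg := abs_timeAverage_le hCg hN
  have hBβ : ∀ x : ℕ → Ω, β ≤ (∑ i ∈ Finset.range N, g (x i)) / N := le_timeAverage hβg hN
  -- pointwise perturbation bound
  have hpt : ∀ x : ℕ → Ω,
      ((∑ i ∈ Finset.range N, f (x i)) / N / ((∑ i ∈ Finset.range N, g (x i)) / N) - a / b) ^ 2
        ≤ 2 / β ^ 2 * (((∑ i ∈ Finset.range N, f (x i)) / N - a) ^ 2
            + (a / b) ^ 2 * ((∑ i ∈ Finset.range N, g (x i)) / N - b) ^ 2) := fun x => by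
    have h := sq_div_sub_div_le (A := (∑ i ∈ Finset.range N, f (x i)) / N)
      (B := (∑ i ∈ Finset.range N, g (x i)) / N) (a := a) hβ (hBβ x) hb0
    exact h.trans_eq (by ring)
  -- integrability of both sides (bounded measurable path functionals)
  have hsqA : Integrable (fun x : ℕ → Ω => ((∑ i ∈ Finset.range N, f (x i)) / N - a) ^ 2) P :=
    integrable_of_bounded P ((hAm.sub measurable_const).pow_const 2) (C := (Cf + |a|) ^ 2) fun x => by
      have hx : |(∑ i ∈ Finset.range N, f (x i)) / N - a| ≤ Cf + |a| :=
        (abs_sub _ _).trans (add_le_add (hAb x) le_rfl)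
      rw [abs_pow]
      exact sq_le_sq' (by linarith [abs_nonneg ((∑ i ∈ Finset.range N, f (x i)) / N - a)]) hx
  have hsqB : Integrable (fun x : ℕ → Ω => ((∑ i ∈ Finset.range N, g (x i)) / N - b) ^ 2) P :=
    integrable_of_bounded P ((hBm.sub measurable_const).pow_const 2) (C := (Cg + |b|) ^ 2) fun x => by
      have hx : |(∑ i ∈ Finset.range N, g (x i)) / N - b| ≤ Cg + |b| :=
        (abs_sub _ _).trans (add_le_add (hBb x) le_rfl)
      rw [abs_pow]
      exact sq_le_sq' (by linarith [abs_nonneg ((∑ i ∈ Finset.range N, g (x i)) / N - b)]) hx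
  have hR : Integrable (fun x : ℕ → Ω => 2 / β ^ 2 * (((∑ i ∈ Finset.range N, f (x i)) / N - a) ^ 2
      + (a / b) ^ 2 * ((∑ i ∈ Finset.range N, g (x i)) / N - b) ^ 2)) P :=
    (hsqA.add (hsqB.const_mul _)).const_mul _
  have hratio_bd : ∀ x : ℕ → Ω,
      |(∑ i ∈ Finset.range N, f (x i)) / N / ((∑ i ∈ Finset.range N, g (x i)) / N)| ≤ Cf / β := fun x => by
    have hBpos : 0 < (∑ i ∈ Finset.range N, g (x i)) / N := hβ.trans_le (hBβ x)
    rw [abs_div, abs_of_pos hBpos]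
    exact div_le_div₀ ((abs_nonneg _).trans (hAb x)) (hAb x) hβ (hBβ x)
  have hL : Integrable (fun x : ℕ → Ω =>
      ((∑ i ∈ Finset.range N, f (x i)) / N / ((∑ i ∈ Finset.range N, g (x i)) / N) - a / b) ^ 2) P :=
    integrable_of_bounded P (((hAm.div hBm).sub measurable_const).pow_const 2)
      (C := (Cf / β + |a / b|) ^ 2) fun x => by
      have hx : |(∑ i ∈ Finset.range N, f (x i)) / N / ((∑ i ∈ Finset.range N, g (x i)) / N) - a / b|
          ≤ Cf / β + |a / b| := (abs_sub _ _).trans (add_le_add (hratio_bd x) le_rfl)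
      have h0 := abs_nonneg
        ((∑ i ∈ Finset.range N, f (x i)) / N / ((∑ i ∈ Finset.range N, g (x i)) / N) - a / b)
      rw [abs_pow]
      exact sq_le_sq' (by linarith) hx
  calc ∫ x, ((∑ i ∈ Finset.range N, f (x i)) / N / ((∑ i ∈ Finset.range N, g (x i)) / N) - a / b) ^ 2 ∂P
      ≤ ∫ x, 2 / β ^ 2 * (((∑ i ∈ Finset.range N, f (x i)) / N - a) ^ 2
          + (a / b) ^ 2 * ((∑ i ∈ Finset.range N, g (x i)) / N - b) ^ 2) ∂P :=
        integral_mono hL hR hpt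
    _ = 2 / β ^ 2 * (∫ x, ((∑ i ∈ Finset.range N, f (x i)) / N - a) ^ 2 ∂P
          + (a / b) ^ 2 * ∫ x, ((∑ i ∈ Finset.range N, g (x i)) / N - b) ^ 2 ∂P) := by
        rw [integral_const_mul, integral_add hsqA (hsqB.const_mul _), integral_const_mul]

/-- **THE CERTIFIED MSE OF THE RATIO ESTIMATOR.**  `π` invariant, `κ(x, ·) ≥ ε π` (`ε > 0`); `f`
bounded measurable (`|f| ≤ C_f`), `g` measurable with `β ≤ g ≤ C_g` (`β > 0`).  For EVERY initial
law `μ₀` and every `N ≥ 1`, with `M_h = (2/ε − 1) Var_π h / N + 16 (C_h + |πh|)² / (ε² N²)`: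
`E_{μ₀}[(A_N/B_N − πf/πg)²] ≤ (2/β²) (M_f + (πf/πg)² M_g)`. -/
theorem chain_ratio_mse_le_of_doeblin (hπ : Kernel.Invariant κ π) {ε : ℝ≥0∞}
    (hmin : ∀ x {B : Set Ω}, MeasurableSet B → ε * π B ≤ κ x B) (hε0 : 0 < ε)
    {f g : Ω → ℝ} (hf : Measurable f) {Cf : ℝ} (hCf : ∀ x, |f x| ≤ Cf)
    (hg : Measurable g) {Cg β : ℝ} (hCg : ∀ x, |g x| ≤ Cg) (hβ : 0 < β) (hβg : ∀ x, β ≤ g x)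
    {N : ℕ} (hN : N ≠ 0) :
    ∫ x, ((∑ i ∈ Finset.range N, f (x i)) / N / ((∑ i ∈ Finset.range N, g (x i)) / N)
          - (∫ z, f z ∂π) / (∫ z, g z ∂π)) ^ 2
        ∂(Kernel.trajMeasure (X := fun _ : ℕ => Ω) μ₀
          (fun n : ℕ => κ.comap (fun h : (i : ↥(Finset.Iic n)) → Ω => h ⟨n, Finset.mem_Iic.2 le_rfl⟩)
            (measurable_pi_apply _)))
      ≤ 2 / β ^ 2 *
        (((2 / ε.toReal - 1) * autocov κ π (fun y => f y - ∫ z, f z ∂π) 0 / N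
            + 16 * (Cf + |∫ z, f z ∂π|) ^ 2 / (ε.toReal ^ 2 * (N : ℝ) ^ 2))
          + ((∫ z, f z ∂π) / (∫ z, g z ∂π)) ^ 2 *
            ((2 / ε.toReal - 1) * autocov κ π (fun y => g y - ∫ z, g z ∂π) 0 / N
              + 16 * (Cg + |∫ z, g z ∂π|) ^ 2 / (ε.toReal ^ 2 * (N : ℝ) ^ 2))) := by
  have hA := chain_mse_le_of_doeblin (μ₀ := μ₀) hπ hmin hε0 hf hCf hN
  have hB := chain_mse_le_of_doeblin (μ₀ := μ₀) hπ hmin hε0 hg hCg hN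
  refine (chain_ratio_mse_le (μ₀ := μ₀) (κ := κ) hf hCf hg hCg hβ hβg hN).trans ?_
  exact mul_le_mul_of_nonneg_left (add_le_add hA (mul_le_mul_of_nonneg_left hB (sq_nonneg _)))
    (by positivity)

end Chain

/-! ### The instance for row 8's protocol class: reweighting along the restart chain -/

section Restart

variable {Ω E : Type*} [MeasurableSpace Ω] [MeasurableSpace E]
variable {κ₀ : Kernel Ω Ω} [IsMarkovKernel κ₀] {κF : Kernel Ω E} [IsMarkovKernel κF]
  {π₀ : Measure Ω} [IsProbabilityMeasure π₀] {μ₀ : Measure (Ω × E)} [IsProbabilityMeasure μ₀]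
  {ε : ℝ≥0∞}

/-- **CERTIFIED MSE OF THE CORRELATED-RESTART REWEIGHTING ESTIMATOR.**  Prior chain `κ₀` with
invariant law `π₀` and `κ₀(x, ·) ≥ ε π₀` (`ε > 0`); evolutions `κF`; restart chain
`K(x, ω) = κ₀ x ⊗ₘ κF` with invariant law `Π = π₀ ⊗ₘ κF`; record observables `G₁` (`|G₁| ≤ C₁`) and
`G₂` (`β ≤ G₂ ≤ C₂`, `β > 0`).  From EVERY initial law and for every `N ≥ 1`, with
`M_j = (2/ε − 1) Var_Π G_j / N + 16 (C_j + |Π G_j|)² / (ε² N²)`: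
`E[(Σ_{i<N} G₁ / Σ_{i<N} G₂ − Π G₁ / Π G₂)²] ≤ (2/β²) (M₁ + (ΠG₁/ΠG₂)² M₂)` (time averages written as
`(1/N) Σ`; the `N`'s cancel in the ratio). -/
theorem restart_ratio_mse_le_of_doeblin (hπ₀ : Kernel.Invariant κ₀ π₀)
    (hmin : ∀ x {B : Set Ω}, MeasurableSet B → ε * π₀ B ≤ κ₀ x B) (hε0 : 0 < ε)
    {G₁ G₂ : Ω × E → ℝ} (hG₁ : Measurable G₁) {C₁ : ℝ} (hC₁ : ∀ p, |G₁ p| ≤ C₁)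
    (hG₂ : Measurable G₂) {C₂ β : ℝ} (hC₂ : ∀ p, |G₂ p| ≤ C₂) (hβ : 0 < β) (hβG : ∀ p, β ≤ G₂ p)
    {N : ℕ} (hN : N ≠ 0) :
    ∫ x, ((∑ i ∈ Finset.range N, G₁ (x i)) / N / ((∑ i ∈ Finset.range N, G₂ (x i)) / N)
          - (∫ p, G₁ p ∂(π₀ ⊗ₘ κF)) / (∫ p, G₂ p ∂(π₀ ⊗ₘ κF))) ^ 2
        ∂(Kernel.trajMeasure (X := fun _ : ℕ => Ω × E) μ₀
          (fun m : ℕ => ((Kernel.prodMkRight E κ₀) ⊗ₖ (Kernel.prodMkLeft (Ω × E) κF)).comap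
            (fun h : (i : ↥(Finset.Iic m)) → Ω × E => h ⟨m, Finset.mem_Iic.2 le_rfl⟩)
            (measurable_pi_apply _)))
      ≤ 2 / β ^ 2 *
        (((2 / ε.toReal - 1)
              * autocov ((Kernel.prodMkRight E κ₀) ⊗ₖ (Kernel.prodMkLeft (Ω × E) κF)) (π₀ ⊗ₘ κF)
                  (fun p => G₁ p - ∫ p', G₁ p' ∂(π₀ ⊗ₘ κF)) 0 / N
            + 16 * (C₁ + |∫ p, G₁ p ∂(π₀ ⊗ₘ κF)|) ^ 2 / (ε.toReal ^ 2 * (N : ℝ) ^ 2))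
          + ((∫ p, G₁ p ∂(π₀ ⊗ₘ κF)) / (∫ p, G₂ p ∂(π₀ ⊗ₘ κF))) ^ 2 *
            ((2 / ε.toReal - 1)
                * autocov ((Kernel.prodMkRight E κ₀) ⊗ₖ (Kernel.prodMkLeft (Ω × E) κF)) (π₀ ⊗ₘ κF)
                    (fun p => G₂ p - ∫ p', G₂ p' ∂(π₀ ⊗ₘ κF)) 0 / N
              + 16 * (C₂ + |∫ p, G₂ p ∂(π₀ ⊗ₘ κF)|) ^ 2 / (ε.toReal ^ 2 * (N : ℝ) ^ 2))) :=
  chain_ratio_mse_le_of_doeblin (μ₀ := μ₀) (invariant_restart hπ₀)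
    (fun p _ hS => restart_doeblin (κF := κF) hmin p hS) hε0 hG₁ hC₁ hG₂ hC₂ hβ hβG hN

end Restart

end Summit.Ventures.LatticeQCDFlow.Scoring

end
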